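import Summits.Ventures.YMGap.FlowData.RectTubeMagneticTwistCoboundary
import HarnessLib

/-!
# Venture YMGap, track Y3 FLOW-DATA — the `SU(2)` magnetic-flux energy of a tube with a TWO-DIMENSIONAL cross-section
# depends only on the PARITY of the number of twisted plaquettes (theorems only)

HONEST FRAMING: venture file of the cell `pub-ymgap` (QuantumFields programme), track Y3 (FLOW-DATA); companion THEOREMS for
`FlowData/RectTubeMagneticTwist.lean` / `RectTubeMagneticTwistCoboundary.lean` (FLOW-PLAN O6 typed).  Spatial cross-section
a `2`-torus `ℤ/L₀ × ℤ/L₁` (`k = 2`, any `L₀, L₁ ≥ 1`), `G = SU(2)`, any real `β`; finite volume, nothing about `L → ∞`, the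
continuum or a mass gap; the SIGN of `E_mag` is not claimed.

On a `2`-torus every plaquette has the orientation `(0, 1)`; the central link field `−1` on ONE link `(x, j)` has coboundary
`−1` on exactly the two plaquettes through that link — the plaquettes based at `x` and at `x − e_i` (`i ≠ j`).  Hence, by the
coboundary invariance `rectMagneticFluxEnergy_linkRescale` (`RectTubeMagneticTwistCoboundary.lean`):

* `su2PlaquetteTwist_symmDiff_adjacent` — toggling two adjacent plaquettes multiplies the twist field by a coboundary;
* **`su2RectMagneticFluxEnergy_symmDiff_adjacent`**, `…_symmDiff_nsmul`, **`su2RectMagneticFluxEnergy_symmDiff_pair`** —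
  `E_mag(β; S ∆ {p} ∆ {q}) = E_mag(β; S)` for ANY two plaquettes `p, q` (walk `q` to `p` link by link);
* **`su2RectMagneticFluxEnergy_pair`** — two distinct twisted plaquettes cost nothing: `E_mag(β; {p, q}) = 0` (`p ≠ q`);
  `su2RectMagneticFluxEnergy_singleton_eq` — `E_mag(β; {p}) = E_mag(β; {q})`;
* **`su2RectMagneticFluxEnergy_eq_of_card_even`** / **`_odd`** / **`su2RectMagneticFluxEnergy_parity`** — THE PARITY THEOREM:
  `E_mag(β; S) = 0` if `#S` is even and `E_mag(β; S) = E_mag(β; {p₀})` (the FLOW-TABLE's one-plaquette magnetic-flux energy) if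
  `#S` is odd: on a `2`-torus cross-section the `ℤ₂` magnetic twist is classified by `∏_q ζ_q`, as for 't Hooft's flux.

References: G. 't Hooft, Nucl. Phys. B 153 (1979) 141, §3 [cite: tHooft1979Flux, §3]; E. T. Tomboulis, L. G. Yaffe, Commun. Math.
Phys. 100 (1985) 313 [cite: TomboulisYaffe1985]; I. Montvay, G. Münster (1994) §3.2.6 [cite: MontvayMunster1994, §3.2.6].
-/

noncomputable section

open scoped BigOperators symmDiff
open MeasureTheory Function
open Literature.MathematicalPhysics.QuantumLattice (RectTorusSite fundamentalRep continuous_fundamentalRep)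
open Summit.Ventures.YMGap.Census (RectPlaquette rectPlaquetteHolonomy)

namespace Summit.Ventures.YMGap.FlowData

section TwoTorus

variable {Ls : Fin 2 → ℕ}

/-- On a `2`-torus the orientation of a plaquette is `(0, 1)`. [folklore] -/
theorem orient2_eq (o : {p : Fin 2 × Fin 2 // p.1 < p.2}) : o = ⟨(0, 1), Fin.zero_lt_one⟩ := by
  obtain ⟨⟨a, b⟩, h⟩ := o
  have h' : a < b := h
  apply Subtype.ext
  show (a, b) = (0, 1)
  fin_cases a <;> fin_cases b <;> simp_all

/-- On a `2`-torus a plaquette is determined by its base site: `q = (q.1, p.2)` for any plaquettes `p, q`. [folklore] -/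
theorem plaq2_eq (p q : RectPlaquette Ls) : q = (q.1, p.2) := by
  obtain ⟨x, o⟩ := q
  rw [orient2_eq o, orient2_eq p.2]

/-- `(−1)⁻¹ = −1` in `SU(2)`. [folklore] -/
theorem su2MinusOne_inv : (su2MinusOne)⁻¹ = su2MinusOne :=
  inv_eq_of_mul_eq_one_right su2MinusOne_mul_self

/-- The single-link field `−1` on the link `e`, `1` elsewhere, is central. [folklore] -/
theorem mulSingle_su2MinusOne_mem_center {k : ℕ} {Ls : Fin k → ℕ} (e e' : RectTorusSite Ls × Fin k) :
    (Pi.mulSingle e su2MinusOne : RectSlice Ls (Matrix.specialUnitaryGroup (Fin 2) ℂ)) e' ∈ Subgroup.center (Matrix.specialUnitaryGroup (Fin 2) ℂ) := by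
  by_cases h : e' = e
  · rw [h, Pi.mulSingle_eq_same]; exact su2MinusOne_mem_center
  · rw [Pi.mulSingle_eq_of_ne h]; exact Subgroup.one_mem _

/-- The `SU(2)` twist field is multiplicative under symmetric difference: `ζ_{A ∆ B} = ζ_A · ζ_B` (`(−1)² = 1`). [folklore] -/
theorem su2PlaquetteTwist_symmDiff {k : ℕ} {Ls : Fin k → ℕ} (A B : Finset (RectPlaquette Ls)) :
    su2PlaquetteTwist (A ∆ B) = fun q => su2PlaquetteTwist A q * su2PlaquetteTwist B q := by
  classical
  funext q
  unfold su2PlaquetteTwist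
  by_cases hA : q ∈ A <;> by_cases hB : q ∈ B <;> simp [Finset.mem_symmDiff, hA, hB, su2MinusOne_mul_self]

/-- The twist field of one plaquette. [folklore] -/
theorem su2PlaquetteTwist_singleton {k : ℕ} {Ls : Fin k → ℕ} (p q : RectPlaquette Ls) :
    su2PlaquetteTwist {p} q = if q = p then su2MinusOne else 1 := by
  classical
  unfold su2PlaquetteTwist
  simp only [Finset.mem_singleton]

/-- Values of the single-link field. [folklore] -/
theorem mulSingle_su2MinusOne_apply (e e' : RectTorusSite Ls × Fin 2) [Decidable (e' = e)] :
    (Pi.mulSingle e su2MinusOne : RectSlice Ls (Matrix.specialUnitaryGroup (Fin 2) ℂ)) e' = if e' = e then su2MinusOne else 1 := by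
  by_cases h : e' = e
  · rw [if_pos h, h, Pi.mulSingle_eq_same]
  · rw [if_neg h, Pi.mulSingle_eq_of_ne h]

/-- **The coboundary of `−1` on a `1`-link of a `2`-torus**: the plaquette holonomy of `Pi.mulSingle (x, 1) (−1)` at the
plaquette based at `y` is `(−1)^{[y = x]} · (−1)^{[y + e₀ = x]}` (the link appears as `(y + e₀, 1)` and as `(y, 1)⁻¹`).
[cite: tHooft1979Flux, §3] -/
theorem rectPlaquetteHolonomy_mulSingle_one (x y : RectTorusSite Ls) :
    rectPlaquetteHolonomy (Pi.mulSingle (x, (1 : Fin 2)) su2MinusOne : RectSlice Ls (Matrix.specialUnitaryGroup (Fin 2) ℂ)) y 0 1 =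
      (if y = x then su2MinusOne else 1) * (if y + Pi.single 0 1 = x then su2MinusOne else 1) := by
  classical
  have hne : ∀ w : RectTorusSite Ls, (w, (0 : Fin 2)) ≠ (x, 1) := fun w h => Fin.zero_ne_one (congrArg Prod.snd h)
  have heq : ∀ w : RectTorusSite Ls, ((w, (1 : Fin 2)) = (x, 1)) = (w = x) := fun w => by
    rw [Prod.mk.injEq, eq_self_iff_true, and_true]
  unfold rectPlaquetteHolonomy
  rw [Pi.mulSingle_eq_of_ne (hne y), Pi.mulSingle_eq_of_ne (hne _), inv_one, one_mul, mul_one,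
    mulSingle_su2MinusOne_apply, mulSingle_su2MinusOne_apply]
  simp only [heq]
  split_ifs <;> simp [su2MinusOne_inv, su2MinusOne_mul_self]

/-- **The coboundary of `−1` on a `0`-link of a `2`-torus**: the plaquette holonomy of `Pi.mulSingle (x, 0) (−1)` at the
plaquette based at `y` is `(−1)^{[y = x]} · (−1)^{[y + e₁ = x]}` (the link appears as `(y, 0)` and as `(y + e₁, 0)⁻¹`).
[cite: tHooft1979Flux, §3] -/
theorem rectPlaquetteHolonomy_mulSingle_zero (x y : RectTorusSite Ls) :
    rectPlaquetteHolonomy (Pi.mulSingle (x, (0 : Fin 2)) su2MinusOne : RectSlice Ls (Matrix.specialUnitaryGroup (Fin 2) ℂ)) y 0 1 =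
      (if y = x then su2MinusOne else 1) * (if y + Pi.single 1 1 = x then su2MinusOne else 1) := by
  classical
  have hne : ∀ w : RectTorusSite Ls, (w, (1 : Fin 2)) ≠ (x, 0) := fun w h => Fin.zero_ne_one (congrArg Prod.snd h).symm
  have heq : ∀ w : RectTorusSite Ls, ((w, (0 : Fin 2)) = (x, 0)) = (w = x) := fun w => by
    rw [Prod.mk.injEq, eq_self_iff_true, and_true]
  unfold rectPlaquetteHolonomy
  rw [Pi.mulSingle_eq_of_ne (hne y), Pi.mulSingle_eq_of_ne (hne _), inv_one, mul_one, mul_one,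
    mulSingle_su2MinusOne_apply, mulSingle_su2MinusOne_apply]
  simp only [heq]
  split_ifs <;> simp [su2MinusOne_inv, su2MinusOne_mul_self]

/-- **The coboundary of `−1` on one link of a `2`-torus.**  For the link `(x, j)` with `j = ![1, 0] i` the direction other
than `i`, the plaquette holonomy of `Pi.mulSingle (x, j) (−1)` at the plaquette based at `y` is
`(−1)^{[y = x]} · (−1)^{[y + e_i = x]}`: it is `−1` exactly on the two plaquettes through the link (based at `x` and at
`x − e_i`; when `L_i = 1` they coincide and the holonomy is trivial). [cite: tHooft1979Flux, §3] -/
theorem rectPlaquetteHolonomy_mulSingle_su2MinusOne (x y : RectTorusSite Ls) (i : Fin 2) :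
    rectPlaquetteHolonomy (Pi.mulSingle (x, (![1, 0] : Fin 2 → Fin 2) i) su2MinusOne : RectSlice Ls (Matrix.specialUnitaryGroup (Fin 2) ℂ)) y 0 1 =
      (if y = x then su2MinusOne else 1) * (if y + Pi.single i 1 = x then su2MinusOne else 1) := by
  fin_cases i
  · exact rectPlaquetteHolonomy_mulSingle_one x y
  · exact rectPlaquetteHolonomy_mulSingle_zero x y

/-- **Toggling two adjacent plaquettes multiplies the `SU(2)` twist field by a coboundary**:
`ζ_{S ∆ {p} ∆ {p − e_i}} = ζ_S · U(γ)` with `γ = −1` on the link `(p.1, j)`, `j ≠ i` (`p − e_i` = the plaquette based at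
`p.1 − e_i`). [cite: tHooft1979Flux, §3] -/
theorem su2PlaquetteTwist_symmDiff_adjacent [∀ i, NeZero (Ls i)] (S : Finset (RectPlaquette Ls)) (p : RectPlaquette Ls)
    (i : Fin 2) :
    su2PlaquetteTwist (S ∆ {p} ∆ {(p.1 - Pi.single i 1, p.2)}) = fun q =>
      su2PlaquetteTwist S q *
        rectPlaquetteHolonomy (Pi.mulSingle (p.1, (![1, 0] : Fin 2 → Fin 2) i) su2MinusOne : RectSlice Ls (Matrix.specialUnitaryGroup (Fin 2) ℂ))
          q.1 q.2.1.1 q.2.1.2 := by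
  classical
  funext q
  have hq : q = (q.1, p.2) := plaq2_eq p q
  have ho : q.2 = ⟨(0, 1), Fin.zero_lt_one⟩ := orient2_eq q.2
  have h01 : (q.2.1.1, q.2.1.2) = ((0 : Fin 2), (1 : Fin 2)) := by rw [ho]
  have h0 : q.2.1.1 = 0 := congrArg Prod.fst h01
  have h1 : q.2.1.2 = 1 := congrArg Prod.snd h01
  -- membership of `q` in the toggled singletons
  have hp : (q = p) = (q.1 = p.1) := propext
    ⟨fun h => congrArg Prod.fst h, fun h => by rw [hq, h]⟩
  have hp' : (q = (p.1 - Pi.single i 1, p.2)) = (q.1 + Pi.single i 1 = p.1) := propext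
    ⟨fun h => by have := congrArg Prod.fst h; simp only at this; rw [this, sub_add_cancel],
     fun h => by rw [hq, ← h, add_sub_cancel_right]⟩
  rw [h0, h1, rectPlaquetteHolonomy_mulSingle_su2MinusOne p.1 q.1 i, su2PlaquetteTwist_symmDiff, su2PlaquetteTwist_symmDiff]
  simp only [su2PlaquetteTwist_singleton, hp, hp', mul_assoc]

variable (β : ℝ) (Ls : Fin 2 → ℕ) [∀ i, NeZero (Ls i)]

/-- **`E_mag(β; S ∆ {p} ∆ {p − e_i}) = E_mag(β; S)`**: toggling two ADJACENT plaquettes does not change the magnetic-flux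
energy (coboundary invariance `rectMagneticFluxEnergy_linkRescale`). [cite: tHooft1979Flux, §3] -/
theorem su2RectMagneticFluxEnergy_symmDiff_adjacent (S : Finset (RectPlaquette Ls)) (p : RectPlaquette Ls) (i : Fin 2) :
    su2RectMagneticFluxEnergy β Ls (S ∆ {p} ∆ {(p.1 - Pi.single i 1, p.2)}) = su2RectMagneticFluxEnergy β Ls S := by
  haveI : SecondCountableTopology (Matrix.specialUnitaryGroup (Fin 2) ℂ) := Literature.MathematicalPhysics.QuantumLattice.secondCountableTopology_su2
  unfold su2RectMagneticFluxEnergy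
  rw [su2PlaquetteTwist_symmDiff_adjacent S p i]
  exact rectMagneticFluxEnergy_linkRescale _ (continuous_fundamentalRep (Fin 2))
    (mulSingle_su2MinusOne_mem_center (p.1, (![1, 0] : Fin 2 → Fin 2) i)) _

/-- `E_mag(β; S ∆ {p} ∆ {p − m·e_i}) = E_mag(β; S)` for every `m` (walk along direction `i`). [cite: tHooft1979Flux, §3] -/
theorem su2RectMagneticFluxEnergy_symmDiff_nsmul (S : Finset (RectPlaquette Ls)) (p : RectPlaquette Ls) (i : Fin 2) (m : ℕ) :
    su2RectMagneticFluxEnergy β Ls (S ∆ {p} ∆ {(p.1 - m • Pi.single i 1, p.2)}) = su2RectMagneticFluxEnergy β Ls S := by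
  induction m with
  | zero => rw [zero_smul, sub_zero, Prod.mk.eta, symmDiff_symmDiff_cancel_right]
  | succ m ih =>
    have hstep : p.1 - (m + 1) • (Pi.single i 1 : RectTorusSite Ls) = (p.1 - m • Pi.single i 1) - Pi.single i 1 := by
      rw [succ_nsmul, sub_sub]
    have hset : S ∆ {p} ∆ {(p.1 - (m + 1) • Pi.single i 1, p.2)} =
        (S ∆ {p} ∆ {(p.1 - m • Pi.single i 1, p.2)}) ∆ {(p.1 - m • Pi.single i 1, p.2)} ∆
          {((p.1 - m • Pi.single i 1) - Pi.single i 1, p.2)} := by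
      rw [symmDiff_symmDiff_cancel_right, hstep]
    rw [hset]
    exact (su2RectMagneticFluxEnergy_symmDiff_adjacent β Ls _ (p.1 - m • Pi.single i 1, p.2) i).trans ih

/-- **`E_mag(β; S ∆ {p} ∆ {q}) = E_mag(β; S)` for ANY two plaquettes `p, q` of the `2`-torus** (walk `q` to `p` along the two
axes; every step is a coboundary). [cite: tHooft1979Flux, §3] -/
theorem su2RectMagneticFluxEnergy_symmDiff_pair (S : Finset (RectPlaquette Ls)) (p q : RectPlaquette Ls) :
    su2RectMagneticFluxEnergy β Ls (S ∆ {p} ∆ {q}) = su2RectMagneticFluxEnergy β Ls S := by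
  -- `q.1 = p.1 − m₀ e₀ − m₁ e₁`
  set x := p.1 with hx
  set m₀ : ℕ := (p.1 0 - q.1 0).val with hm₀
  set w := x - m₀ • (Pi.single 0 1 : RectTorusSite Ls) with hw
  set m₁ : ℕ := (w 1 - q.1 1).val with hm₁
  have hq1 : w - m₁ • (Pi.single 1 1 : RectTorusSite Ls) = q.1 := by
    funext j
    fin_cases j
    · show w 0 - (m₁ • (Pi.single (1 : Fin 2) (1 : ZMod (Ls 1)) : RectTorusSite Ls)) 0 = q.1 0
      rw [Pi.smul_apply, Pi.single_eq_of_ne (by decide : (0 : Fin 2) ≠ 1), smul_zero, sub_zero, hw, Pi.sub_apply,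
        Pi.smul_apply, Pi.single_eq_same, nsmul_eq_mul, mul_one, hm₀, ZMod.natCast_zmod_val, hx, sub_sub_cancel]
    · show w 1 - (m₁ • (Pi.single (1 : Fin 2) (1 : ZMod (Ls 1)) : RectTorusSite Ls)) 1 = q.1 1
      rw [Pi.smul_apply, Pi.single_eq_same, nsmul_eq_mul, mul_one, hm₁, ZMod.natCast_zmod_val, sub_sub_cancel]
  set p' : RectPlaquette Ls := (w, p.2) with hp'
  have hq : q = (p'.1 - m₁ • Pi.single 1 1, p'.2) := by rw [hq1]; exact plaq2_eq p q
  have hw' : p' = (p.1 - m₀ • Pi.single 0 1, p.2) := rfl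
  calc su2RectMagneticFluxEnergy β Ls (S ∆ {p} ∆ {q})
      = su2RectMagneticFluxEnergy β Ls ((S ∆ {p} ∆ {p'}) ∆ {p'} ∆ {(p'.1 - m₁ • Pi.single 1 1, p'.2)}) := by
        rw [symmDiff_symmDiff_cancel_right, ← hq]
    _ = su2RectMagneticFluxEnergy β Ls (S ∆ {p} ∆ {p'}) := su2RectMagneticFluxEnergy_symmDiff_nsmul β Ls _ p' 1 m₁
    _ = su2RectMagneticFluxEnergy β Ls S := by rw [hw']; exact su2RectMagneticFluxEnergy_symmDiff_nsmul β Ls S p 0 m₀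

/-- **Two distinct twisted plaquettes cost nothing on a `2`-torus cross-section: `E_mag(β; {p, q}) = 0`** (`p ≠ q`).
[cite: tHooft1979Flux, §3] -/
theorem su2RectMagneticFluxEnergy_pair {p q : RectPlaquette Ls} (hpq : p ≠ q) :
    su2RectMagneticFluxEnergy β Ls {p, q} = 0 := by
  classical
  have hset : ({p, q} : Finset (RectPlaquette Ls)) = ∅ ∆ {p} ∆ {q} := by
    rw [show (∅ : Finset (RectPlaquette Ls)) ∆ {p} = {p} from bot_symmDiff _]
    ext r
    rw [Finset.mem_insert, Finset.mem_singleton, Finset.mem_symmDiff, Finset.mem_singleton, Finset.mem_singleton]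
    constructor
    · rintro (rfl | rfl)
      · exact Or.inl ⟨rfl, hpq⟩
      · exact Or.inr ⟨rfl, fun h => hpq h.symm⟩
    · rintro (⟨h, -⟩ | ⟨h, -⟩)
      · exact Or.inl h
      · exact Or.inr h
  rw [hset, su2RectMagneticFluxEnergy_symmDiff_pair, su2RectMagneticFluxEnergy_empty]

/-- `E_mag(β; {p}) = E_mag(β; {q})` for any two plaquettes (also a case of translation invariance). [cite: tHooft1979Flux, §3] -/
theorem su2RectMagneticFluxEnergy_singleton_eq (p q : RectPlaquette Ls) :
    su2RectMagneticFluxEnergy β Ls {p} = su2RectMagneticFluxEnergy β Ls {q} := by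
  have hset : ({p} : Finset (RectPlaquette Ls)) = {q} ∆ {q} ∆ {p} := by
    rw [symmDiff_self, bot_symmDiff]
  rw [hset, su2RectMagneticFluxEnergy_symmDiff_pair]

/-- Removing two distinct elements of `S` is a double toggle: `S = ((S \ {p}) \ {q}) ∆ {q} ∆ {p}`. [folklore] -/
theorem erase_erase_symmDiff {α : Type*} [DecidableEq α] {S : Finset α} {p q : α} (hp : p ∈ S) (hq : q ∈ S.erase p) :
    ((S.erase p).erase q) ∆ {q} ∆ {p} = S := by
  ext r
  simp only [Finset.mem_symmDiff, Finset.mem_erase, Finset.mem_singleton]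
  have hqp : q ≠ p := (Finset.mem_erase.1 hq).1
  have hqS : q ∈ S := (Finset.mem_erase.1 hq).2
  by_cases hrp : r = p
  · subst hrp; simp [hp, hqp.symm]
  · by_cases hrq : r = q
    · subst hrq; simp [hqS, hqp]
    · simp [hrp, hrq]

/-- **Toggling an EVEN set of plaquettes does not change the magnetic-flux energy**: `E_mag(β; S ∆ D) = E_mag(β; S)` whenever
`#D` is even (pair off the plaquettes of `D`). [cite: tHooft1979Flux, §3] -/
theorem su2RectMagneticFluxEnergy_symmDiff_of_card_even (S : Finset (RectPlaquette Ls)) {D : Finset (RectPlaquette Ls)}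
    (hD : Even D.card) : su2RectMagneticFluxEnergy β Ls (S ∆ D) = su2RectMagneticFluxEnergy β Ls S := by
  classical
  -- strong induction on the cardinality of `D`, removing two plaquettes at a time
  suffices h : ∀ n : ℕ, ∀ D : Finset (RectPlaquette Ls), D.card = n → Even n →
      su2RectMagneticFluxEnergy β Ls (S ∆ D) = su2RectMagneticFluxEnergy β Ls S from h _ D rfl hD
  intro n
  induction n using Nat.strong_induction_on with
  | _ n ih =>
    intro D hDn hn
    by_cases h0 : D.card = 0
    · rw [Finset.card_eq_zero.1 h0]
      exact congrArg _ (symmDiff_bot S)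
    · have h1 : D.card ≠ 1 := by
        intro h1; rw [← hDn, h1] at hn; exact Nat.not_even_one hn
      obtain ⟨a, ha⟩ : D.Nonempty := Finset.card_pos.1 (by omega)
      have hcard : (D.erase a).card = D.card - 1 := Finset.card_erase_of_mem ha
      obtain ⟨b, hb⟩ : (D.erase a).Nonempty := Finset.card_pos.1 (by omega)
      have hcard2 : ((D.erase a).erase b).card = D.card - 2 := by
        rw [Finset.card_erase_of_mem hb, hcard]; omega
      rw [← erase_erase_symmDiff ha hb, ← symmDiff_assoc, ← symmDiff_assoc, su2RectMagneticFluxEnergy_symmDiff_pair]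
      refine ih (D.card - 2) (by omega) _ hcard2 ?_
      rw [← hDn] at hn
      obtain ⟨r, hr⟩ := hn
      exact ⟨r - 1, by omega⟩

/-- **THE PARITY THEOREM, even case: an even number of twisted plaquettes costs nothing on a `2`-torus cross-section**:
`E_mag(β; S) = 0` whenever `#S` is even. [cite: tHooft1979Flux, §3] -/
theorem su2RectMagneticFluxEnergy_eq_of_card_even {S : Finset (RectPlaquette Ls)} (hS : Even S.card) :
    su2RectMagneticFluxEnergy β Ls S = 0 := by
  have h := su2RectMagneticFluxEnergy_symmDiff_of_card_even β Ls ∅ hS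
  rwa [show (∅ : Finset (RectPlaquette Ls)) ∆ S = S from bot_symmDiff _, su2RectMagneticFluxEnergy_empty] at h

/-- **THE PARITY THEOREM, odd case: an odd number of twisted plaquettes costs exactly one**: `E_mag(β; S) = E_mag(β; {p₀})`
(the FLOW-TABLE's one-plaquette magnetic-flux energy) whenever `#S` is odd, for any reference plaquette `p₀`.
[cite: tHooft1979Flux, §3] -/
theorem su2RectMagneticFluxEnergy_eq_of_card_odd {S : Finset (RectPlaquette Ls)} (hS : Odd S.card) (p₀ : RectPlaquette Ls) :
    su2RectMagneticFluxEnergy β Ls S = su2RectMagneticFluxEnergy β Ls {p₀} := by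
  classical
  -- `S = {p₀} ∆ D` with `D = {p₀} ∆ S` of even cardinality
  have heven : Even (({p₀} : Finset (RectPlaquette Ls)) ∆ S).card := by
    by_cases h0 : p₀ ∈ S
    · have hset : ({p₀} : Finset (RectPlaquette Ls)) ∆ S = S.erase p₀ := by
        ext r; simp only [Finset.mem_symmDiff, Finset.mem_erase, Finset.mem_singleton]
        by_cases hr : r = p₀
        · subst hr; simp [h0]
        · simp [hr]
      rw [hset, Finset.card_erase_of_mem h0]
      obtain ⟨r, hr⟩ := hS; exact ⟨r, by omega⟩
    · have hset : ({p₀} : Finset (RectPlaquette Ls)) ∆ S = insert p₀ S := by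
        ext r; simp only [Finset.mem_symmDiff, Finset.mem_singleton, Finset.mem_insert]
        by_cases hr : r = p₀
        · subst hr; simp [h0]
        · simp [hr]
      rw [hset, Finset.card_insert_of_notMem h0]
      obtain ⟨r, hr⟩ := hS; exact ⟨r + 1, by omega⟩
  have h := su2RectMagneticFluxEnergy_symmDiff_of_card_even β Ls {p₀} heven
  rwa [symmDiff_symmDiff_cancel_left] at h

/-- **THE PARITY THEOREM**: on a `2`-torus cross-section the `SU(2)` magnetic-flux energy of a plaquette set `S` is
`0` if `#S` is even and the one-plaquette value `E_mag(β; {p₀})` if `#S` is odd — the `ℤ₂` magnetic twist is classified by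
`∏_q ζ_q`, exactly as 't Hooft's flux. [cite: tHooft1979Flux, §3] -/
theorem su2RectMagneticFluxEnergy_parity (S : Finset (RectPlaquette Ls)) (p₀ : RectPlaquette Ls) :
    su2RectMagneticFluxEnergy β Ls S = if Even S.card then 0 else su2RectMagneticFluxEnergy β Ls {p₀} := by
  split_ifs with h
  · exact su2RectMagneticFluxEnergy_eq_of_card_even β Ls h
  · exact su2RectMagneticFluxEnergy_eq_of_card_odd β Ls (Nat.not_even_iff_odd.1 h) p₀

end TwoTorus

end Summit.Ventures.YMGap.FlowData
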